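import Summits.CriticalPhenomena.PercolationContinuityZ3.Theorems.PercNearOneGluingNoHeavyLowerTailQuantitativeOneSideSizeLemma
import Summits.CriticalPhenomena.PercolationContinuityZ3.Theorems.PercNearOneGluingNoHeavyLowerTailCSHDefs
import Summits.CriticalPhenomena.PercolationContinuityZ3.Theorems.PercNearOneGluingNoHeavyLowerTailQuantitativePairLawPrep
import HarnessLib

/-!
# The PAIR-FUNCTIONAL SIZE LAW (BENCH rows M2-R56 / M2-R57 (C2), PROOFS §P54 (i′)(i″), §P56 (C2)):
# `covD(w; x; {y}; 1{xa ∈ 𝒞_x}; u) ≤ (1 − t)·(1 + (|V| − 3)·t) · isoCov`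

Support file (`--supports stmt-CriticalPhenomena-4575`), prover seat `prim-rate-mine-2` (lane prim-rate, constants-miner (c);
`run/shared/lean/prim/prim-rate/prim-rate-mine-2/PROOFS.md` §P54 (i′)(i″), §P56 (C2); BENCH rows l.194 M2-R56, l.197 M2-R57).
No definitions, no named facts, no sorries; standard axioms.

SETTING.  Pair weights `w` on a finite vertex type; distinct `x, a, y`, an observer `u ≠ y`; the ghost vertex `y` hangs on `a` only:
`w{c,y} = 0` for `c ≠ a`, `t := w{a,y}`; `p := w{x,a}`.  The PRINCIPAL PAIR FUNCTIONAL is `f(C) = 1{s(x,a) ∈ C}` (the functional's own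
pair is open), so `CSH.covD w x {y} f u = μ(D)·μ(D ∩ {x↔u} ∩ {xa open}) − μ(D ∩ {xa open})·μ(D ∩ {x↔u})`, `D = {x ↮ y}`, and the
ISOLATED covariance is `isoCov = μ₀({xa open} ∩ {x↔u}) − μ₀(xa open)·μ₀(x↔u)` under `μ₀ = μ_{w[{a,y}↦0]}` (the `Y`-pair deleted).
Side graph `H′` = all pairs avoiding `y` and different from `{x,a}`; its statistics `λ = μ(u ↔_{H′} a, u ↮_{H′} x)`,
`φ = μ(x↔_{H′} a ∧ u ↔_{H′} {x,a}) − μ(x ↔_{H′} a)·μ(u ↔_{H′} {x,a})` (the ONE-SIDE statistics of `…OneSideSizeLemma` with `b := u`).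

* **`CSH.pairLaw_isoCov_eq`** — `isoCov = p(1−p)·λ`;  **`CSH.pairLaw_covD_eq`** — `covD = (1−t)·p(1−p)·(λ + t·φ)`
  (PROOFS §P54 (i′): `covD/isoCov = (1−t)(1+Λt)`, `Λ = φ/λ`, i.e. the first-order constant is `c_pair = Λ − 1`);
* **`CSH.pairLaw_covD_le`** — `covD ≤ (1 − t)·(1 + (|V| − 3)·t)·isoCov`: by the ONE-SIDE SIZE LEMMA applied to `H′`
  (`CSH.oneSideCov_le_count_mul`, at most `|V| − 3` counted vertices: not `x`, not `a`, not the isolated `y`), `φ ≤ (|V|−3)·λ` —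
  THE PAIR-FUNCTIONAL SIZE LAW `c_pair ≤ |V ∖ {y}| − 3` for EVERY `n` (BENCH l.194 (b)(c) «for all n», l.197 (C2)); sharp by the
  towers of BENCH l.181.
Mechanism: on the sure set, `x ↔ y ⟺ ({a,y} open ∧ x ↔ a off y)` and `x ↔ u ⟺ x ↔ u off y` (the tree's amalgamation
`KNSep.reachable_iff_exists_rB_rT` / `reachable_iff_rT` with the one-point separator `{a}` of `{y}`); then one conditions on the pair
`{x,a}` (`reachable_insert_iff`), and the two independent pairs factor out (`KNSep.real_inter_of_determinedBy_compl`).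
[cite: VandenbergHaggstromKahn2005, Thm. 1.3 (p. 6), §2.1 Lemma 2.3 (p. 10)] [cite: KozmaNitzan2024, proof of Thm. 3 (pp. 10–11)]
-/

noncomputable section

namespace Summit.CriticalPhenomena.PercolationContinuityZ3.Theorems.CSH

open MeasureTheory Set unitInterval
open Literature.Probability.LatticeModels (prodBernoulli prodBernoulli_real_setOf_mem)
open Literature.Probability.Percolation
open Literature.Probability.Percolation.KNSep
open scoped Classical

variable {V : Type*} [Fintype V]

section PairLaw

variable (w : Sym2 V → unitInterval) (x a u y : V)


/-! ### The fourth probability, the conditioned covariance and the law -/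

/-- Events agreeing on the sure set have the same probability (pointwise form). [folklore] -/
private theorem pairLaw_real_congr {E E' : Set (BondConfig V)} (h : ∀ ω ∈ sureSet w, ω ∈ E ↔ ω ∈ E') :
    (prodBernoulli w).real E = (prodBernoulli w).real E' :=
  real_eq_of_inter_sureSet w (Set.ext fun ω =>
    ⟨fun hω => ⟨(h ω hω.2).1 hω.1, hω.2⟩, fun hω => ⟨(h ω hω.2).2 hω.1, hω.2⟩⟩)

variable {x a u y}
variable (hy : ∀ c, c ≠ a → w s(c, y) = 0) (hxy : x ≠ y) (hay : a ≠ y) (hxa : x ≠ a) (huy : u ≠ y)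
include hy hxy hay hxa huy

/-- `μ(D ∩ {x↔u}) = p(1−t)·β + (1−p)(1−t)·ξ + (1−p)t·(ξ − κ)`, `ξ = μ(u ↔_{H′} x)`, `κ = μ(x ↔_{H′} a ∧ u ↔_{H′} x)`. [folklore] -/
theorem pairLaw_real_DG : (prodBernoulli w).real ((({ω : BondConfig V | ∀ y' ∈ ({y} : Set V), ¬ (openGraph ω).Reachable x y'} : Set (BondConfig V))) ∩ openConn x u) =
    (w s(x, a) : ℝ) * (1 - (w s(a, y) : ℝ)) * (prodBernoulli w).real ((({ω : BondConfig V | (openGraph (ω ∩ ((sideT ({y} : Set V) ({a} : Set V) \ {s(x, a)})))).Reachable u x} : Set (BondConfig V))) ∪ (({ω : BondConfig V | (openGraph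
          (ω ∩ ((sideT ({y} : Set V) ({a} : Set V) \ {s(x, a)})))).Reachable u a} : Set (BondConfig V)))) +
      (1 - (w s(x, a) : ℝ)) * (1 - (w s(a, y) : ℝ)) * (prodBernoulli w).real (({ω : BondConfig V | (openGraph (ω ∩ ((sideT ({y} : Set V) ({a} : Set V) \ {s(x, a)})))).Reachable u x} : Set (BondConfig V))) +
      (1 - (w s(x, a) : ℝ)) * (w s(a, y) : ℝ) * (prodBernoulli w).real ((({ω : BondConfig V | (openGraph (ω ∩ ((sideT ({y} : Set V) ({a} : Set V) \ {s(x, a)})))).Reachable u x} : Set (BondConfig V))) ∩ (({ω : BondConfig V | (openGraph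
            (ω ∩ ((sideT ({y} : Set V) ({a} : Set V) \ {s(x, a)})))).Reachable x a} : Set (BondConfig V)))ᶜ) := by
  obtain ⟨lO1, lO0, lY1, lY0⟩ := pairLaw_real_lit w x a y
  have i1 := pairLaw_indep w x a y hxy hay True False
    (fun η => (openGraph η).Reachable u x ∨ (openGraph η).Reachable u a)
  have i2 := pairLaw_indep w x a y hxy hay False False (fun η => (openGraph η).Reachable u x)
  have i3 := pairLaw_indep w x a y hxy hay False True
    (fun η => (openGraph η).Reachable u x ∧ ¬ (openGraph η).Reachable x a)
  set S1 := ({ω : BondConfig V | (s(x, a) ∈ ω ↔ True)} ∩ ({ω | (s(a, y) ∈ ω ↔ False)} ∩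
        {ω | (fun η => (openGraph η).Reachable u x ∨ (openGraph η).Reachable u a) (ω ∩ ((sideT ({y} : Set V) ({a} : Set V) \ {s(x, a)})))})) with hS1
  set S2 := ({ω : BondConfig V | (s(x, a) ∈ ω ↔ False)} ∩ ({ω | (s(a, y) ∈ ω ↔ False)} ∩
        {ω | (fun η => (openGraph η).Reachable u x) (ω ∩ ((sideT ({y} : Set V) ({a} : Set V) \ {s(x, a)})))})) with hS2
  set S3 := ({ω : BondConfig V | (s(x, a) ∈ ω ↔ False)} ∩ ({ω | (s(a, y) ∈ ω ↔ True)} ∩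
        {ω | (fun η => (openGraph η).Reachable u x ∧ ¬ (openGraph η).Reachable x a) (ω ∩ ((sideT ({y} : Set V) ({a} : Set V) \ {s(x, a)})))})) with hS3
  have hset : (prodBernoulli w).real ((({ω : BondConfig V | ∀ y' ∈ ({y} : Set V), ¬ (openGraph ω).Reachable x y'} : Set (BondConfig V))) ∩ openConn x u) = (prodBernoulli w).real ((S1 ∪ S2) ∪ S3) :=
    pairLaw_real_congr w fun ω hω => by
      obtain ⟨hD, hG⟩ := pairLaw_pointwise w hy hxy hay hxa huy hω
      simp only [hS1, hS2, hS3, Set.mem_union, Set.mem_inter_iff, Set.mem_setOf_eq, iff_true, iff_false, hD]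
      rw [show ω ∈ (openConn x u : Set (BondConfig V)) ↔ _ from hG]
      constructor
      · rintro ⟨h1, h2⟩
        by_cases ho : s(x, a) ∈ ω
        · have hny : s(a, y) ∉ ω := fun h => h1 ⟨h, Or.inl ho⟩
          refine Or.inl (Or.inl ⟨ho, hny, ?_⟩)
          rcases h2 with h | ⟨-, h⟩
          · exact Or.inl h.symm
          · exact Or.inr h.symm
        · have hxu : (openGraph (ω ∩ ((sideT ({y} : Set V) ({a} : Set V) \ {s(x, a)})))).Reachable x u := by
            rcases h2 with h | ⟨h, -⟩
            · exact h
            · exact absurd h ho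
          by_cases hey : s(a, y) ∈ ω
          · exact Or.inr ⟨ho, hey, hxu.symm, fun h => h1 ⟨hey, Or.inr h⟩⟩
          · exact Or.inl (Or.inr ⟨ho, hey, hxu.symm⟩)
      · rintro ((⟨ho, hny, h⟩ | ⟨ho, hny, h⟩) | ⟨ho, hey, h, hna⟩)
        · refine ⟨fun h' => hny h'.1, ?_⟩
          rcases h with h | h
          · exact Or.inl h.symm
          · exact Or.inr ⟨ho, h.symm⟩
        · exact ⟨fun h' => hny h'.1, Or.inl h.symm⟩
        · refine ⟨fun h' => ?_, Or.inl h.symm⟩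
          rcases h'.2 with h'' | h''
          · exact ho h''
          · exact hna h''
  have hd12 : Disjoint S1 S2 := Set.disjoint_left.2 fun ω h1 h2 => by
    simp only [hS1, hS2, Set.mem_inter_iff, Set.mem_setOf_eq, iff_true, iff_false] at h1 h2; exact h2.1 h1.1
  have hd3 : Disjoint (S1 ∪ S2) S3 := Set.disjoint_left.2 fun ω h1 h2 => by
    simp only [hS1, hS2, hS3, Set.mem_union, Set.mem_inter_iff, Set.mem_setOf_eq, iff_true, iff_false] at h1 h2
    rcases h1 with h1 | h1
    · exact h1.2.1 h2.2.1
    · exact h1.2.1 h2.2.1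
  rw [hset, measureReal_union hd3 MeasurableSet.of_discrete, measureReal_union hd12 MeasurableSet.of_discrete,
    hS1, hS2, hS3, i1, i2, i3, lO1, lO0, lY1, lY0]
  have e1 : {ω : BondConfig V | (fun η => (openGraph η).Reachable u x ∨ (openGraph η).Reachable u a) (ω ∩ ((sideT ({y} : Set V) ({a} : Set V) \ {s(x, a)})))} = ((({ω : BondConfig V | (openGraph (ω ∩ ((sideT ({y} : Set V) ({a} : Set V)
        \ {s(x, a)})))).Reachable u x} : Set (BondConfig V))) ∪ (({ω : BondConfig V | (openGraph (ω ∩ ((sideT ({y} : Set V) ({a} : Set V) \ {s(x, a)})))).Reachable u a} : Set (BondConfig V)))) := rfl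
  have e2 : {ω : BondConfig V | (fun η => (openGraph η).Reachable u x) (ω ∩ ((sideT ({y} : Set V) ({a} : Set V) \ {s(x, a)})))} = (({ω : BondConfig V | (openGraph (ω ∩ ((sideT ({y} : Set V) ({a} : Set V) \ {s(x, a)})))).Reachable u x}
        : Set (BondConfig V))) := rfl
  have e3 : {ω : BondConfig V | (fun η => (openGraph η).Reachable u x ∧ ¬ (openGraph η).Reachable x a) (ω ∩ ((sideT ({y} : Set V) ({a} : Set V) \ {s(x, a)})))} = ((({ω : BondConfig V | (openGraph (ω ∩ ((sideT ({y} : Set V) ({a} : Set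
        V) \ {s(x, a)})))).Reachable u x} : Set (BondConfig V))) ∩ (({ω : BondConfig V | (openGraph (ω ∩ ((sideT ({y} : Set V) ({a} : Set V) \ {s(x, a)})))).Reachable x a} : Set (BondConfig V)))ᶜ) := rfl
  rw [e1, e2, e3]; ring

/-! ### The conditioned covariance of the pair functional -/

omit [Fintype V] hy hxy hay huy in
/-- The principal pair functional read off the open edge cluster of `x` is the indicator of «the pair `{x,a}` is open». [folklore] -/
theorem pairLaw_functional_eq (ω : BondConfig V) :
    (if s(x, a) ∈ openEdgeCluster ω x then (1 : ℝ) else 0) = ((({ω : BondConfig V | s(x, a) ∈ ω} : Set (BondConfig V)))).indicator 1 ω := by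
  by_cases ho : s(x, a) ∈ ω
  · have hmem : s(x, a) ∈ openEdgeCluster ω x := by
      refine (mem_openEdgeCluster_iff ω x _).2 ⟨ho, fun h => hxa (Sym2.mk_isDiag_iff.1 h), fun v hv => ?_⟩
      rcases Sym2.mem_iff.1 hv with h | h <;> rw [h]
      exact SimpleGraph.Adj.reachable ((openGraph_adj ω x a).2 ⟨ho, hxa⟩)
    rw [if_pos hmem, Set.indicator_of_mem (show ω ∈ (({ω : BondConfig V | s(x, a) ∈ ω} : Set (BondConfig V))) from ho), Pi.one_apply]
  · have hnot : s(x, a) ∉ openEdgeCluster ω x := fun h => ho (openEdgeCluster_subset ω x h)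
    rw [if_neg hnot, Set.indicator_of_notMem (show ω ∉ (({ω : BondConfig V | s(x, a) ∈ ω} : Set (BondConfig V))) from ho)]

omit hy hxy hay huy in
/-- A set integral of the pair functional is a probability. [folklore] -/
theorem pairLaw_setIntegral_eq (S : Set (BondConfig V)) :
    ∫ ω in S, (fun C : Set (Sym2 V) => if s(x, a) ∈ C then (1 : ℝ) else 0) (openEdgeCluster ω x) ∂(prodBernoulli w) =
      (prodBernoulli w).real (S ∩ (({ω : BondConfig V | s(x, a) ∈ ω} : Set (BondConfig V)))) := by
  simp only [pairLaw_functional_eq hxa]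
  rw [setIntegral_indicator MeasurableSet.of_discrete]
  simp only [Pi.one_apply, setIntegral_const, smul_eq_mul, mul_one]

omit hy hxy hay hxa huy in
/-- The side statistics `β = ξ + λ` and `μ(X₂ ∖ A₂) = ξ − κ`, `μ(A₂ ∩ (X₂ ∪ B₂)) = κ`. [folklore] -/
theorem pairLaw_side_arith :
    (prodBernoulli w).real ((({ω : BondConfig V | (openGraph (ω ∩ ((sideT ({y} : Set V) ({a} : Set V) \ {s(x, a)})))).Reachable u x} : Set (BondConfig V))) ∪ (({ω : BondConfig V | (openGraph (ω ∩ ((sideT ({y} : Set V) ({a} : Set V) \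
          {s(x, a)})))).Reachable u a} : Set (BondConfig V)))) = (prodBernoulli w).real (({ω : BondConfig V | (openGraph (ω ∩ ((sideT ({y} : Set V) ({a} : Set V) \ {s(x, a)})))).Reachable u x} : Set (BondConfig V))) + (prodBernoulli
          w).real ((({ω : BondConfig V | (openGraph (ω ∩ ((sideT ({y} : Set V) ({a} : Set V) \ {s(x, a)})))).Reachable u a} : Set (BondConfig V))) ∩ (({ω : BondConfig V | (openGraph (ω ∩ ((sideT ({y} : Set V) ({a} : Set V) \ {s(x,
          a)})))).Reachable u x} : Set (BondConfig V)))ᶜ) ∧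
    (prodBernoulli w).real ((({ω : BondConfig V | (openGraph (ω ∩ ((sideT ({y} : Set V) ({a} : Set V) \ {s(x, a)})))).Reachable u x} : Set (BondConfig V))) ∩ (({ω : BondConfig V | (openGraph (ω ∩ ((sideT ({y} : Set V) ({a} : Set V) \
          {s(x, a)})))).Reachable x a} : Set (BondConfig V)))ᶜ) = (prodBernoulli w).real (({ω : BondConfig V | (openGraph (ω ∩ ((sideT ({y} : Set V) ({a} : Set V) \ {s(x, a)})))).Reachable u x} : Set (BondConfig V))) - (prodBernoulli
          w).real ((({ω : BondConfig V | (openGraph (ω ∩ ((sideT ({y} : Set V) ({a} : Set V) \ {s(x, a)})))).Reachable x a} : Set (BondConfig V))) ∩ (({ω : BondConfig V | (openGraph (ω ∩ ((sideT ({y} : Set V) ({a} : Set V) \ {s(x,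
          a)})))).Reachable u x} : Set (BondConfig V)))) ∧
    (prodBernoulli w).real ((({ω : BondConfig V | (openGraph (ω ∩ ((sideT ({y} : Set V) ({a} : Set V) \ {s(x, a)})))).Reachable x a} : Set (BondConfig V))) ∩ ((({ω : BondConfig V | (openGraph (ω ∩ ((sideT ({y} : Set V) ({a} : Set V) \
          {s(x, a)})))).Reachable u x} : Set (BondConfig V))) ∪ (({ω : BondConfig V | (openGraph (ω ∩ ((sideT ({y} : Set V) ({a} : Set V) \ {s(x, a)})))).Reachable u a} : Set (BondConfig V))))) = (prodBernoulli w).real ((({ω :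
          BondConfig V | (openGraph (ω ∩ ((sideT ({y} : Set V) ({a} : Set V) \ {s(x, a)})))).Reachable x a} : Set (BondConfig V))) ∩ (({ω : BondConfig V | (openGraph (ω ∩ ((sideT ({y} : Set V) ({a} : Set V) \ {s(x, a)})))).Reachable u
          x} : Set (BondConfig V)))) := by
  refine ⟨?_, ?_, ?_⟩
  · have h : ((({ω : BondConfig V | (openGraph (ω ∩ ((sideT ({y} : Set V) ({a} : Set V) \ {s(x, a)})))).Reachable u x} : Set (BondConfig V))) ∪ (({ω : BondConfig V | (openGraph (ω ∩ ((sideT ({y} : Set V) ({a} : Set V) \ {s(x,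
        a)})))).Reachable u a} : Set (BondConfig V)))) = ((({ω : BondConfig V | (openGraph (ω ∩ ((sideT ({y} : Set V) ({a} : Set V) \ {s(x, a)})))).Reachable u x} : Set (BondConfig V))) ∪ ((({ω : BondConfig V | (openGraph (ω ∩ ((sideT
        ({y} : Set V) ({a} : Set V) \ {s(x, a)})))).Reachable u a} : Set (BondConfig V))) ∩ (({ω : BondConfig V | (openGraph (ω ∩ ((sideT ({y} : Set V) ({a} : Set V) \ {s(x, a)})))).Reachable u x} : Set (BondConfig V)))ᶜ)) := by
      ext ω; simp only [Set.mem_union, Set.mem_inter_iff, Set.mem_compl_iff, Set.mem_setOf_eq]; tauto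
    rw [h, measureReal_union (Set.disjoint_left.2 fun ω h1 h2 => h2.2 h1) MeasurableSet.of_discrete]
  · have h := measureReal_inter_add_sdiff (μ := prodBernoulli w) (s := ((({ω : BondConfig V | (openGraph (ω ∩ ((sideT ({y} : Set V) ({a} : Set V) \ {s(x, a)})))).Reachable u x} : Set (BondConfig V))))) (t := ((({ω : BondConfig V |
        (openGraph (ω ∩ ((sideT ({y} : Set V) ({a} : Set V) \ {s(x, a)})))).Reachable x a} : Set (BondConfig V))))) MeasurableSet.of_discrete
    have e1 : ((({ω : BondConfig V | (openGraph (ω ∩ ((sideT ({y} : Set V) ({a} : Set V) \ {s(x, a)})))).Reachable u x} : Set (BondConfig V))) ∩ (({ω : BondConfig V | (openGraph (ω ∩ ((sideT ({y} : Set V) ({a} : Set V) \ {s(x,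
          a)})))).Reachable x a} : Set (BondConfig V)))ᶜ) = ((({ω : BondConfig V | (openGraph (ω ∩ ((sideT ({y} : Set V) ({a} : Set V) \ {s(x, a)})))).Reachable u x} : Set (BondConfig V))) \ (({ω : BondConfig V | (openGraph (ω ∩
          ((sideT ({y} : Set V) ({a} : Set V) \ {s(x, a)})))).Reachable x a} : Set (BondConfig V)))) := rfl
    have e2 : ((({ω : BondConfig V | (openGraph (ω ∩ ((sideT ({y} : Set V) ({a} : Set V) \ {s(x, a)})))).Reachable x a} : Set (BondConfig V))) ∩ (({ω : BondConfig V | (openGraph (ω ∩ ((sideT ({y} : Set V) ({a} : Set V) \ {s(x,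
          a)})))).Reachable u x} : Set (BondConfig V)))) = ((({ω : BondConfig V | (openGraph (ω ∩ ((sideT ({y} : Set V) ({a} : Set V) \ {s(x, a)})))).Reachable u x} : Set (BondConfig V))) ∩ (({ω : BondConfig V | (openGraph (ω ∩
          ((sideT ({y} : Set V) ({a} : Set V) \ {s(x, a)})))).Reachable x a} : Set (BondConfig V)))) := Set.inter_comm _ _
    rw [e1, e2]; linarith
  · congr 1; ext ω; simp only [Set.mem_inter_iff, Set.mem_union, Set.mem_setOf_eq]
    exact ⟨fun ⟨h1, h2⟩ => ⟨h1, h2.elim id fun h => h.trans h1.symm⟩, fun ⟨h1, h2⟩ => ⟨h1, Or.inl h2⟩⟩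

/-- **The conditioned covariance of the principal pair functional, exactly** (PROOFS §P54 (i′)):
`covD(w; x; {y}; 1{xa ∈ 𝒞_x}; u) = (1 − t)·p·(1 − p)·(λ + t·φ)` with `t = w{a,y}`, `p = w{x,a}` and the one-side statistics of the side
graph `H′` (pairs off `y` other than `{x,a}`): `λ = μ(u ↔_{H′} a, u ↮_{H′} x)`, `φ = μ(x ↔_{H′} a ∧ u ↔_{H′} {x,a}) − μ(x ↔_{H′} a)·μ(u ↔_{H′} {x,a})`.
[cite: VandenbergHaggstromKahn2005, Thm. 1.3 (p. 6), §2.1 Lemma 2.3 (p. 10)] -/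
theorem pairLaw_covD_eq :
    covD w x {y} (fun C => if s(x, a) ∈ C then (1 : ℝ) else 0) u =
      (1 - (w s(a, y) : ℝ)) * (w s(x, a) : ℝ) * (1 - (w s(x, a) : ℝ)) *
        ((prodBernoulli w).real ((({ω : BondConfig V | (openGraph (ω ∩ ((sideT ({y} : Set V) ({a} : Set V) \ {s(x, a)})))).Reachable u a} : Set (BondConfig V))) ∩ (({ω : BondConfig V | (openGraph (ω ∩ ((sideT ({y} : Set V) ({a} : Set
              V) \ {s(x, a)})))).Reachable u x} : Set (BondConfig V)))ᶜ) +
          (w s(a, y) : ℝ) * ((prodBernoulli w).real ((({ω : BondConfig V | (openGraph (ω ∩ ((sideT ({y} : Set V) ({a} : Set V) \ {s(x, a)})))).Reachable x a} : Set (BondConfig V))) ∩ ((({ω : BondConfig V | (openGraph (ω ∩ ((sideT ({y}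
                : Set V) ({a} : Set V) \ {s(x, a)})))).Reachable u x} : Set (BondConfig V))) ∪ (({ω : BondConfig V | (openGraph (ω ∩ ((sideT ({y} : Set V) ({a} : Set V) \ {s(x, a)})))).Reachable u a} : Set (BondConfig V))))) -
            (prodBernoulli w).real (({ω : BondConfig V | (openGraph (ω ∩ ((sideT ({y} : Set V) ({a} : Set V) \ {s(x, a)})))).Reachable x a} : Set (BondConfig V))) * (prodBernoulli w).real ((({ω : BondConfig V | (openGraph (ω ∩ ((sideT
                  ({y} : Set V) ({a} : Set V) \ {s(x, a)})))).Reachable u x} : Set (BondConfig V))) ∪ (({ω : BondConfig V | (openGraph (ω ∩ ((sideT ({y} : Set V) ({a} : Set V) \ {s(x, a)})))).Reachable u a} : Set (BondConfig V))))))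
                  := by
  obtain ⟨a1, a2, a3⟩ := pairLaw_side_arith w (x := x) (a := a) (u := u) (y := y)
  rw [covD, pairLaw_setIntegral_eq w hxa, pairLaw_setIntegral_eq w hxa, pairLaw_real_D w hy hxy hay hxa huy,
    pairLaw_real_DGO w hy hxy hay hxa huy, pairLaw_real_DO w hy hxy hay hxa huy, pairLaw_real_DG w hy hxy hay hxa huy,
    a1, a2, a3]
  ring

/-- **The isolated covariance of the pair functional** (the `Y`-pair deleted, `μ₀ = μ_{w[{a,y}↦0]}`):
`μ₀({xa open} ∩ {x↔u}) − μ₀(xa open)·μ₀(x↔u) = p(1−p)·λ`. [cite: VandenbergHaggstromKahn2005, Thm. 1.3 (p. 6)] -/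
theorem pairLaw_isoCov_eq :
    (prodBernoulli (Function.update w s(a, y) 0)).real ((({ω : BondConfig V | s(x, a) ∈ ω} : Set (BondConfig V))) ∩ openConn x u) -
        (prodBernoulli (Function.update w s(a, y) 0)).real (({ω : BondConfig V | s(x, a) ∈ ω} : Set (BondConfig V))) *
          (prodBernoulli (Function.update w s(a, y) 0)).real (openConn x u) =
      (w s(x, a) : ℝ) * (1 - (w s(x, a) : ℝ)) * (prodBernoulli w).real ((({ω : BondConfig V | (openGraph (ω ∩ ((sideT ({y} : Set V) ({a} : Set V) \ {s(x, a)})))).Reachable u a} : Set (BondConfig V))) ∩ (({ω : BondConfig V | (openGraph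
            (ω ∩ ((sideT ({y} : Set V) ({a} : Set V) \ {s(x, a)})))).Reachable u x} : Set (BondConfig V)))ᶜ) := by
  obtain ⟨hne, hE, hY⟩ := pairLaw_pairs x a y hxy hay
  set w₀ := Function.update w s(a, y) 0 with hw₀
  have hy₀ : ∀ c, c ≠ a → w₀ s(c, y) = 0 := fun c hc => by
    rw [hw₀, Function.update_of_ne (fun h => ?_)]
    · exact hy c hc
    · rcases Sym2.eq_iff.1 h with ⟨h1, -⟩ | ⟨-, h2⟩
      · exact hc h1
      · exact hay h2.symm
  have ht₀ : (w₀ s(a, y) : ℝ) = 0 := by rw [hw₀, Function.update_self]; rfl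
  have hp₀ : w₀ s(x, a) = w s(x, a) := by rw [hw₀, Function.update_of_ne hne]
  have hagree : ∀ e ∈ ((sideT ({y} : Set V) ({a} : Set V) \ {s(x, a)})), w₀ e = w e := fun e he => by
    rw [hw₀, Function.update_of_ne (fun h => hY (by rw [← h]; exact he))]
  have eT : ∀ Q : Set (Sym2 V) → Prop, (prodBernoulli w₀).real {ω | Q (ω ∩ ((sideT ({y} : Set V) ({a} : Set V) \ {s(x, a)})))} = (prodBernoulli w).real {ω | Q (ω ∩ ((sideT ({y} : Set V) ({a} : Set V) \ {s(x, a)})))} :=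
    fun Q => real_eq_of_agree w₀ w _ hagree (determinedBy_setOf_inter _ Q)
  have hD1 : (prodBernoulli w₀).real (({ω : BondConfig V | ∀ y' ∈ ({y} : Set V), ¬ (openGraph ω).Reachable x y'} : Set (BondConfig V))) = 1 := by
    rw [pairLaw_real_D w₀ hy₀ hxy hay hxa huy, ht₀]; ring
  have m2 := pairLaw_real_DGO w₀ hy₀ hxy hay hxa huy
  have m4 := pairLaw_real_DG w₀ hy₀ hxy hay hxa huy
  rw [ht₀, hp₀] at m2 m4
  have e1 : (prodBernoulli w₀).real ((({ω : BondConfig V | s(x, a) ∈ ω} : Set (BondConfig V))) ∩ openConn x u) = (prodBernoulli w₀).real ((({ω : BondConfig V | ∀ y' ∈ ({y} : Set V), ¬ (openGraph ω).Reachable x y'} : Set (BondConfig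
        V))) ∩ openConn x u ∩ (({ω : BondConfig V | s(x, a) ∈ ω} : Set (BondConfig V)))) := by
    rw [Set.inter_assoc, osl_real_inter_of_eq_one _ hD1, Set.inter_comm]
  have e2 : (prodBernoulli w₀).real (openConn x u) = (prodBernoulli w₀).real ((({ω : BondConfig V | ∀ y' ∈ ({y} : Set V), ¬ (openGraph ω).Reachable x y'} : Set (BondConfig V))) ∩ openConn x u) :=
    (osl_real_inter_of_eq_one _ hD1).symm
  have e3 : (prodBernoulli w₀).real (({ω : BondConfig V | s(x, a) ∈ ω} : Set (BondConfig V))) = w s(x, a) := by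
    have := prodBernoulli_real_setOf_mem w₀ s(x, a); rw [hp₀] at this; exact this
  have b1 := eT (fun η => (openGraph η).Reachable u x ∨ (openGraph η).Reachable u a)
  have b2 := eT (fun η => (openGraph η).Reachable u x)
  have b1' : (prodBernoulli w₀).real ((({ω : BondConfig V | (openGraph (ω ∩ ((sideT ({y} : Set V) ({a} : Set V) \ {s(x, a)})))).Reachable u x} : Set (BondConfig V))) ∪ (({ω : BondConfig V | (openGraph (ω ∩ ((sideT ({y} : Set V) ({a} :
        Set V) \ {s(x, a)})))).Reachable u a} : Set (BondConfig V)))) = (prodBernoulli w).real ((({ω : BondConfig V | (openGraph (ω ∩ ((sideT ({y} : Set V) ({a} : Set V) \ {s(x, a)})))).Reachable u x} : Set (BondConfig V))) ∪ (({ω :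
        BondConfig V | (openGraph (ω ∩ ((sideT ({y} : Set V) ({a} : Set V) \ {s(x, a)})))).Reachable u a} : Set (BondConfig V)))) := b1
  have b2' : (prodBernoulli w₀).real (({ω : BondConfig V | (openGraph (ω ∩ ((sideT ({y} : Set V) ({a} : Set V) \ {s(x, a)})))).Reachable u x} : Set (BondConfig V))) = (prodBernoulli w).real (({ω : BondConfig V | (openGraph (ω ∩
        ((sideT ({y} : Set V) ({a} : Set V) \ {s(x, a)})))).Reachable u x} : Set (BondConfig V))) := b2
  obtain ⟨a1, -, -⟩ := pairLaw_side_arith w (x := x) (a := a) (u := u) (y := y)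
  rw [e1, e2, e3, m2, m4, b1', b2', a1]
  ring

/-! ### The one-side bound on the side graph and the PAIR-FUNCTIONAL SIZE LAW -/

omit hy hxy hay hxa huy in
/-- Under a weight function vanishing off a set of pairs `E`, connection events may be read off `ω ∩ E`. [folklore] -/
private theorem pairLaw_real_restrict_eq (E : Set (Sym2 V)) [DecidablePred (· ∈ E)] (P : Set (Sym2 V) → Prop) :
    (prodBernoulli fun e : Sym2 V => if e ∈ E then w e else 0).real {ω | P ω} =
      (prodBernoulli w).real {ω | P (ω ∩ E)} := by
  have h1 : (prodBernoulli fun e : Sym2 V => if e ∈ E then w e else 0).real {ω | P ω} =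
      (prodBernoulli fun e : Sym2 V => if e ∈ E then w e else 0).real {ω | P (ω ∩ E)} := by
    refine real_eq_of_inter_sureSet _ (Set.ext fun ω => ?_)
    simp only [Set.mem_inter_iff, Set.mem_setOf_eq]
    constructor
    · rintro ⟨h, hω⟩
      have : ω ∩ E = ω := Set.inter_eq_left.2 fun e he => by
        by_contra heE
        exact (hω e).1 (by simp only [heE, if_false]) he
      exact ⟨by rwa [this], hω⟩
    · rintro ⟨h, hω⟩
      have : ω ∩ E = ω := Set.inter_eq_left.2 fun e he => by
        by_contra heE
        exact (hω e).1 (by simp only [heE, if_false]) he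
      exact ⟨by rwa [this] at h, hω⟩
  rw [h1]
  exact real_eq_of_agree _ w E (fun e he => by simp only [he, if_true]) (determinedBy_setOf_inter E P)

omit hy huy in
/-- **The one-side bound on the side graph `H′`**: `φ ≤ (|V| − 3)·λ` — the ONE-SIDE SIZE LEMMA for `w` restricted to the pairs off `y`
other than `{x,a}`; the count excludes `x`, `a` and the isolated `y`. [cite: VandenbergHaggstromKahn2005, Thm. 1.3 (p. 6)] -/
theorem pairLaw_phi_le :
    (prodBernoulli w).real ((({ω : BondConfig V | (openGraph (ω ∩ ((sideT ({y} : Set V) ({a} : Set V) \ {s(x, a)})))).Reachable x a} : Set (BondConfig V))) ∩ ((({ω : BondConfig V | (openGraph (ω ∩ ((sideT ({y} : Set V) ({a} : Set V) \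
          {s(x, a)})))).Reachable u x} : Set (BondConfig V))) ∪ (({ω : BondConfig V | (openGraph (ω ∩ ((sideT ({y} : Set V) ({a} : Set V) \ {s(x, a)})))).Reachable u a} : Set (BondConfig V))))) - (prodBernoulli w).real (({ω :
          BondConfig V | (openGraph (ω ∩ ((sideT ({y} : Set V) ({a} : Set V) \ {s(x, a)})))).Reachable x a} : Set (BondConfig V))) * (prodBernoulli w).real ((({ω : BondConfig V | (openGraph (ω ∩ ((sideT ({y} : Set V) ({a} : Set V) \
          {s(x, a)})))).Reachable u x} : Set (BondConfig V))) ∪ (({ω : BondConfig V | (openGraph (ω ∩ ((sideT ({y} : Set V) ({a} : Set V) \ {s(x, a)})))).Reachable u a} : Set (BondConfig V)))) ≤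
      ((Fintype.card V : ℝ) - 3) * (prodBernoulli w).real ((({ω : BondConfig V | (openGraph (ω ∩ ((sideT ({y} : Set V) ({a} : Set V) \ {s(x, a)})))).Reachable u a} : Set (BondConfig V))) ∩ (({ω : BondConfig V | (openGraph (ω ∩ ((sideT
            ({y} : Set V) ({a} : Set V) \ {s(x, a)})))).Reachable u x} : Set (BondConfig V)))ᶜ) := by
  have h : (prodBernoulli ((fun e : Sym2 V => if e ∈ (sideT ({y} : Set V) ({a} : Set V) \ {s(x, a)}) then w e else 0))).real {ω | (openGraph ω).Reachable x a ∧
        ((openGraph ω).Reachable u x ∨ (openGraph ω).Reachable u a)} -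
      (prodBernoulli ((fun e : Sym2 V => if e ∈ (sideT ({y} : Set V) ({a} : Set V) \ {s(x, a)}) then w e else 0))).real {ω | (openGraph ω).Reachable x a} *
        (prodBernoulli ((fun e : Sym2 V => if e ∈ (sideT ({y} : Set V) ({a} : Set V) \ {s(x, a)}) then w e else 0))).real {ω | (openGraph ω).Reachable u x ∨ (openGraph ω).Reachable u a} ≤
      ((Finset.univ.filter fun v : V => v ≠ x ∧ 0 < (prodBernoulli ((fun e : Sym2 V => if e ∈ (sideT ({y} : Set V) ({a} : Set V) \ {s(x, a)}) then w e else 0))).real (openConn a v) ∧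
        (prodBernoulli ((fun e : Sym2 V => if e ∈ (sideT ({y} : Set V) ({a} : Set V) \ {s(x, a)}) then w e else 0))).real (openConn a v) < 1).card : ℝ) *
      (prodBernoulli ((fun e : Sym2 V => if e ∈ (sideT ({y} : Set V) ({a} : Set V) \ {s(x, a)}) then w e else 0))).real {ω | (openGraph ω).Reachable u a ∧ ¬ (openGraph ω).Reachable u x} :=
    oneSideCov_le_count_mul ((fun e : Sym2 V => if e ∈ (sideT ({y} : Set V) ({a} : Set V) \ {s(x, a)}) then w e else 0)) x a u
  have e1 : (prodBernoulli ((fun e : Sym2 V => if e ∈ (sideT ({y} : Set V) ({a} : Set V) \ {s(x, a)}) then w e else 0))).real {ω | (openGraph ω).Reachable x a ∧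
        ((openGraph ω).Reachable u x ∨ (openGraph ω).Reachable u a)} = (prodBernoulli w).real ((({ω : BondConfig V | (openGraph (ω ∩ ((sideT ({y} : Set V) ({a} : Set V) \ {s(x, a)})))).Reachable x a} : Set (BondConfig V))) ∩ ((({ω :
              BondConfig V | (openGraph (ω ∩ ((sideT ({y} : Set V) ({a} : Set V) \ {s(x, a)})))).Reachable u x} : Set (BondConfig V))) ∪ (({ω : BondConfig V | (openGraph (ω ∩ ((sideT ({y} : Set V) ({a} : Set V) \ {s(x,
              a)})))).Reachable u a} : Set (BondConfig V))))) :=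
    pairLaw_real_restrict_eq w ((sideT ({y} : Set V) ({a} : Set V) \ {s(x, a)})) (fun η => (openGraph η).Reachable x a ∧ ((openGraph η).Reachable u x ∨ (openGraph η).Reachable u a))
  have e2 : (prodBernoulli ((fun e : Sym2 V => if e ∈ (sideT ({y} : Set V) ({a} : Set V) \ {s(x, a)}) then w e else 0))).real {ω | (openGraph ω).Reachable x a} = (prodBernoulli w).real (({ω : BondConfig V | (openGraph (ω ∩ ((sideT
        ({y} : Set V) ({a} : Set V) \ {s(x, a)})))).Reachable x a} : Set (BondConfig V))) :=
    pairLaw_real_restrict_eq w ((sideT ({y} : Set V) ({a} : Set V) \ {s(x, a)})) (fun η => (openGraph η).Reachable x a)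
  have e3 : (prodBernoulli ((fun e : Sym2 V => if e ∈ (sideT ({y} : Set V) ({a} : Set V) \ {s(x, a)}) then w e else 0))).real {ω | (openGraph ω).Reachable u x ∨ (openGraph ω).Reachable u a} =
      (prodBernoulli w).real ((({ω : BondConfig V | (openGraph (ω ∩ ((sideT ({y} : Set V) ({a} : Set V) \ {s(x, a)})))).Reachable u x} : Set (BondConfig V))) ∪ (({ω : BondConfig V | (openGraph (ω ∩ ((sideT ({y} : Set V) ({a} : Set V)
            \ {s(x, a)})))).Reachable u a} : Set (BondConfig V)))) :=
    pairLaw_real_restrict_eq w ((sideT ({y} : Set V) ({a} : Set V) \ {s(x, a)})) (fun η => (openGraph η).Reachable u x ∨ (openGraph η).Reachable u a)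
  have e4 : (prodBernoulli ((fun e : Sym2 V => if e ∈ (sideT ({y} : Set V) ({a} : Set V) \ {s(x, a)}) then w e else 0))).real {ω | (openGraph ω).Reachable u a ∧ ¬ (openGraph ω).Reachable u x} =
      (prodBernoulli w).real ((({ω : BondConfig V | (openGraph (ω ∩ ((sideT ({y} : Set V) ({a} : Set V) \ {s(x, a)})))).Reachable u a} : Set (BondConfig V))) ∩ (({ω : BondConfig V | (openGraph (ω ∩ ((sideT ({y} : Set V) ({a} : Set V)
            \ {s(x, a)})))).Reachable u x} : Set (BondConfig V)))ᶜ) :=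
    pairLaw_real_restrict_eq w ((sideT ({y} : Set V) ({a} : Set V) \ {s(x, a)})) (fun η => (openGraph η).Reachable u a ∧ ¬ (openGraph η).Reachable u x)
  have hk : ((Finset.univ.filter fun v : V => v ≠ x ∧ 0 < (prodBernoulli ((fun e : Sym2 V => if e ∈ (sideT ({y} : Set V) ({a} : Set V) \ {s(x, a)}) then w e else 0))).real (openConn a v) ∧
      (prodBernoulli ((fun e : Sym2 V => if e ∈ (sideT ({y} : Set V) ({a} : Set V) \ {s(x, a)}) then w e else 0))).real (openConn a v) < 1).card : ℝ) ≤ (Fintype.card V : ℝ) - 3 := by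
    have hsub : (Finset.univ.filter fun v : V => v ≠ x ∧ 0 < (prodBernoulli ((fun e : Sym2 V => if e ∈ (sideT ({y} : Set V) ({a} : Set V) \ {s(x, a)}) then w e else 0))).real (openConn a v) ∧
        (prodBernoulli ((fun e : Sym2 V => if e ∈ (sideT ({y} : Set V) ({a} : Set V) \ {s(x, a)}) then w e else 0))).real (openConn a v) < 1) ⊆ ((Finset.univ.erase x).erase a).erase y := by
      intro v hv
      rw [Finset.mem_filter] at hv
      refine Finset.mem_erase.2 ⟨fun hvy => ?_, Finset.mem_erase.2 ⟨fun hva => ?_, Finset.mem_erase.2 ⟨hv.2.1, Finset.mem_univ _⟩⟩⟩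
      · -- `y` is isolated under the side weights
        have h0 : (prodBernoulli ((fun e : Sym2 V => if e ∈ (sideT ({y} : Set V) ({a} : Set V) \ {s(x, a)}) then w e else 0))).real (openConn a v : Set (BondConfig V)) = 0 := by
          have hr : (prodBernoulli ((fun e : Sym2 V => if e ∈ (sideT ({y} : Set V) ({a} : Set V) \ {s(x, a)}) then w e else 0))).real {ω | (openGraph ω).Reachable a v} =
              (prodBernoulli w).real {ω | (openGraph (ω ∩ ((sideT ({y} : Set V) ({a} : Set V) \ {s(x, a)})))).Reachable a v} :=
            pairLaw_real_restrict_eq w ((sideT ({y} : Set V) ({a} : Set V) \ {s(x, a)})) (fun η => (openGraph η).Reachable a v)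
          rw [show (openConn a v : Set (BondConfig V)) = {ω | (openGraph ω).Reachable a v} from rfl, hr]
          refine le_antisymm ((measureReal_mono fun ω hω => ?_).trans (le_of_eq measureReal_empty)) measureReal_nonneg
          have hmem := @osl_reachable_mem_of_closed V (ω ∩ ((sideT ({y} : Set V) ({a} : Set V) \ {s(x, a)}))) {z' : V | z' ≠ y} a v hay
            (fun z _ y' hy' he => hy' fun h => he.2.1.1 y' (Sym2.mem_mk_right z y') (Set.mem_singleton_iff.2 h)) hω
          exact hmem hvy
        exact absurd h0 (ne_of_gt hv.2.2.1)
      · rw [hva] at hv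
        have : (prodBernoulli ((fun e : Sym2 V => if e ∈ (sideT ({y} : Set V) ({a} : Set V) \ {s(x, a)}) then w e else 0))).real (openConn a a : Set (BondConfig V)) = 1 := by
          rw [show (openConn a a : Set (BondConfig V)) = Set.univ from
            Set.eq_univ_of_forall fun _ => SimpleGraph.Reachable.refl _]
          exact probReal_univ
        exact absurd this (ne_of_lt hv.2.2.2)
    have hc := Finset.card_le_card hsub
    rw [Finset.card_erase_of_mem (Finset.mem_erase.2 ⟨Ne.symm hay, Finset.mem_erase.2 ⟨Ne.symm hxy, Finset.mem_univ _⟩⟩),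
      Finset.card_erase_of_mem (Finset.mem_erase.2 ⟨Ne.symm hxa, Finset.mem_univ _⟩),
      Finset.card_erase_of_mem (Finset.mem_univ _), Finset.card_univ] at hc
    have h3 : 3 ≤ Fintype.card V := by
      have : ({x, a, y} : Finset V).card ≤ Fintype.card V := Finset.card_le_univ _
      rw [Finset.card_insert_of_notMem (by simp [hxa, hxy]), Finset.card_pair hay] at this
      omega
    have : ((Finset.univ.filter fun v : V => v ≠ x ∧ 0 < (prodBernoulli ((fun e : Sym2 V => if e ∈ (sideT ({y} : Set V) ({a} : Set V) \ {s(x, a)}) then w e else 0))).real (openConn a v) ∧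
        (prodBernoulli ((fun e : Sym2 V => if e ∈ (sideT ({y} : Set V) ({a} : Set V) \ {s(x, a)}) then w e else 0))).real (openConn a v) < 1).card : ℝ) + 3 ≤ Fintype.card V := by
      exact_mod_cast (by omega : (Finset.univ.filter fun v : V => v ≠ x ∧ 0 < (prodBernoulli ((fun e : Sym2 V => if e ∈ (sideT ({y} : Set V) ({a} : Set V) \ {s(x, a)}) then w e else 0))).real (openConn a v) ∧
        (prodBernoulli ((fun e : Sym2 V => if e ∈ (sideT ({y} : Set V) ({a} : Set V) \ {s(x, a)}) then w e else 0))).real (openConn a v) < 1).card + 3 ≤ Fintype.card V)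
    linarith
  rw [e1, e2, e3, e4] at h
  exact h.trans (mul_le_mul_of_nonneg_right hk measureReal_nonneg)

/-- **THE PAIR-FUNCTIONAL SIZE LAW** (PROOFS §P54 (i″), §P56 (C2); BENCH l.194 / l.197 (C2)).  With the ghost pair `{a,y}` of weight `t`
hanging on `a` only, the principal pair functional `f = 1{xa ∈ 𝒞_x}` and any observer `u ≠ y`:
`covD(w; x; {y}; f; u) ≤ (1 − t)·(1 + (|V| − 3)·t)·[μ₀(xa open ∧ x↔u) − μ₀(xa open)·μ₀(x↔u)]`, `μ₀ = μ_{w[{a,y}↦0]}` —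
i.e. the first-order constant of the pair functional obeys `c_pair ≤ |V| − 4 = |V ∖ {y}| − 3` on EVERY weighted graph (sharp by the towers
of BENCH l.181). [cite: VandenbergHaggstromKahn2005, Thm. 1.3 (p. 6), §2.1 Lemma 2.3 (p. 10)] -/
theorem pairLaw_covD_le :
    covD w x {y} (fun C => if s(x, a) ∈ C then (1 : ℝ) else 0) u ≤
      (1 - (w s(a, y) : ℝ)) * (1 + ((Fintype.card V : ℝ) - 3) * (w s(a, y) : ℝ)) *
        ((prodBernoulli (Function.update w s(a, y) 0)).real ((({ω : BondConfig V | s(x, a) ∈ ω} : Set (BondConfig V))) ∩ openConn x u) -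
          (prodBernoulli (Function.update w s(a, y) 0)).real (({ω : BondConfig V | s(x, a) ∈ ω} : Set (BondConfig V))) *
            (prodBernoulli (Function.update w s(a, y) 0)).real (openConn x u)) := by
  rw [pairLaw_covD_eq w hy hxy hay hxa huy, pairLaw_isoCov_eq w hy hxy hay hxa huy]
  have hφ := pairLaw_phi_le w (u := u) hxy hay hxa
  set lam := (prodBernoulli w).real ((({ω : BondConfig V | (openGraph (ω ∩ ((sideT ({y} : Set V) ({a} : Set V) \ {s(x, a)})))).Reachable u a} : Set (BondConfig V))) ∩ (({ω : BondConfig V | (openGraph (ω ∩ ((sideT ({y} : Set V) ({a} :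
        Set V) \ {s(x, a)})))).Reachable u x} : Set (BondConfig V)))ᶜ)
  set phi := (prodBernoulli w).real ((({ω : BondConfig V | (openGraph (ω ∩ ((sideT ({y} : Set V) ({a} : Set V) \ {s(x, a)})))).Reachable x a} : Set (BondConfig V))) ∩ ((({ω : BondConfig V | (openGraph (ω ∩ ((sideT ({y} : Set V) ({a} :
        Set V) \ {s(x, a)})))).Reachable u x} : Set (BondConfig V))) ∪ (({ω : BondConfig V | (openGraph (ω ∩ ((sideT ({y} : Set V) ({a} : Set V) \ {s(x, a)})))).Reachable u a} : Set (BondConfig V))))) - (prodBernoulli w).real (({ω :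
        BondConfig V | (openGraph (ω ∩ ((sideT ({y} : Set V) ({a} : Set V) \ {s(x, a)})))).Reachable x a} : Set (BondConfig V))) * (prodBernoulli w).real ((({ω : BondConfig V | (openGraph (ω ∩ ((sideT ({y} : Set V) ({a} : Set V) \
        {s(x, a)})))).Reachable u x} : Set (BondConfig V))) ∪ (({ω : BondConfig V | (openGraph (ω ∩ ((sideT ({y} : Set V) ({a} : Set V) \ {s(x, a)})))).Reachable u a} : Set (BondConfig V))))
  set t : ℝ := (w s(a, y) : ℝ)
  set p : ℝ := (w s(x, a) : ℝ)
  have ht0 : 0 ≤ t := (w s(a, y)).2.1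
  have ht1 : t ≤ 1 := (w s(a, y)).2.2
  have hp0 : 0 ≤ p := (w s(x, a)).2.1
  have hp1 : p ≤ 1 := (w s(x, a)).2.2
  have hl0 : 0 ≤ lam := measureReal_nonneg
  have hk3 : phi ≤ ((Fintype.card V : ℝ) - 3) * lam := hφ
  have h1 : t * phi ≤ t * (((Fintype.card V : ℝ) - 3) * lam) := mul_le_mul_of_nonneg_left hk3 ht0
  have hc : 0 ≤ (1 - t) * p * (1 - p) := mul_nonneg (mul_nonneg (by linarith) hp0) (by linarith)
  calc (1 - t) * p * (1 - p) * (lam + t * phi)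
      ≤ (1 - t) * p * (1 - p) * (lam + t * (((Fintype.card V : ℝ) - 3) * lam)) :=
        mul_le_mul_of_nonneg_left (by linarith) hc
    _ = (1 - t) * (1 + ((Fintype.card V : ℝ) - 3) * t) * (p * (1 - p) * lam) := by ring

end PairLaw

end Summit.CriticalPhenomena.PercolationContinuityZ3.Theorems.CSH
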